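import Summits.CriticalPhenomena.PercolationContinuityZ3.Theorems.Transplant.SkelPhiParaRunSteps
import Summits.CriticalPhenomena.PercolationContinuityZ3.Theorems.Transplant.SkelPhiQStepsN
import HarnessLib

/-!
# Quasi-step rung (N3-b), BINDER-WAVE PILOT ROW of WAVE-Q-MANIFEST v0.5 (§5 / rows TSV): the COLUMN DEVICE of the run frames under (ι) := `Skelφ.QStepsN G φ M` —
# every point of the run plane is `runX φ c₀ n h σ g` for a vertex `g` within graph distance `M·(…)` of the run origin (the `×M` twin of «SkelPhiParaRunSteps»
# `exists_mem_graphBall_runX_eq / runY_eq`, which assumed `Steps G φ`)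

builds on p205010 (kernel theorem, internal audit signed; external expert review pending) — nothing in this file uses p205010; nothing here is a claim about any open node; no carrier,
no node, no definition.  Lane `prim-bschramm`, seat `prim-bschramm-gen-1` (gen 4; GEN pen).  Helper file (`--supports stmt-CriticalPhenomena-4575 --as helper`).
WHY (pilot of the binder wave: the hunk classes of a THREAD-ONLY module).  The tree file takes `hstep : Steps G φ` only to call the LEVEL-0 primitive `exists_mem_graphBall_φ_eq`
(radius `‖Δ‖₁`); under the rung's currency the call is `Skelφ.QStepsN.exists_mem_graphBall_eq hq` (radius `M·‖Δ‖₁`), so the binder becomes `{M} (hq : QStepsN G φ M)` and the ONE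
radius in each statement is multiplied by `M` — hunk classes (i) binder, (iv) radius ×M; proofs otherwise byte-identical.  Regression: `qStepsN_of_steps`, M = 1.
* **`exists_mem_graphBall_runX_eq_q`**, **`exists_mem_graphBall_runY_eq_q`**.
[cite: KozmaNitzan2024, §4 p. 26 ((29))] [cite: MartineauTassion2017, §3 (the sheared coordinates)]
-/

noncomputable section

namespace Summit.CriticalPhenomena.PercolationContinuityZ3.Theorems.Transplant

namespace Skelφ

open Literature.Probability.Percolation Literature.Probability.LatticeModels SimpleGraph
open Literature.Barriers.CriticalPhenomena (graphBall graphBall_mono)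

variable {V : Type} {G : SimpleGraph V} {φ : V → Site 2}





/-- **The column device of the x-frame**: under `QStepsN G φ M` (`1 ≤ n`, `σ = ±1`), every run-plane point `y` is `runX φ c₀ n h σ g` for a vertex `g` within graph
distance `M·(|y₀| + ((n+|h|)·|y₁| + |h|·|y₀| + (n+|h|))/n + 1)` of the run origin `c₀`. [cite: KozmaNitzan2024, §4 p. 26 ((29))] -/
theorem exists_mem_graphBall_runX_eq_q {M : ℕ} (hq : QStepsN G φ M) {n : ℕ} (hn : 1 ≤ n) (c₀ : V) (h : ℤ) {σ : ℤ} (hσ : σ = 1 ∨ σ = -1) (y : Site 2) :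
    ∃ g, g ∈ graphBall G c₀ (M * ((y 0).natAbs + (((shearUnit n h : ℤ) * |y 1| + |h| * |y 0| + shearUnit n h) / n).natAbs + 1)) ∧
      runX φ c₀ n h σ g = y := by
  have hσσ : σ * σ = 1 := by rcases hσ with rfl | rfl <;> simp
  have hn0 : (0 : ℤ) < n := by exact_mod_cast hn
  have hc := shearUnit_pos hn h
  -- along: `a := σ y₀`; transverse target window `[c y₁ + h y₀, c y₁ + h y₀ + c − 1]` for `n e − h y₀ + h y₀`
  obtain ⟨e, he1, he2, he3⟩ := exists_mul_mem_Icc hn0 ((shearUnit n h : ℤ) * y 1 + h * y 0)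
  -- the vertex with `φ g = φ c₀ + (σ y₀, σ e)`
  obtain ⟨g, hg, hφ⟩ := QStepsN.exists_mem_graphBall_eq hq c₀ (fun i => if i = 0 then φ c₀ 0 + σ * y 0 else φ c₀ 1 + σ * e)
  have hz0 : (fun i : Fin 2 => if i = 0 then φ c₀ 0 + σ * y 0 else φ c₀ 1 + σ * e) 0 - φ c₀ 0 = σ * y 0 := by simp
  have hz1 : (fun i : Fin 2 => if i = 0 then φ c₀ 0 + σ * y 0 else φ c₀ 1 + σ * e) 1 - φ c₀ 1 = σ * e := by simp
  refine ⟨g, graphBall_mono G c₀ ?_ hg, ?_⟩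
  · -- the distance bound
    rw [hz0, hz1, Int.natAbs_mul, Int.natAbs_mul]
    have hσn : σ.natAbs = 1 := by rcases hσ with rfl | rfl <;> simp
    rw [hσn, one_mul, one_mul]
    have hTabs : |(shearUnit n h : ℤ) * y 1 + h * y 0| ≤ (shearUnit n h : ℤ) * |y 1| + |h| * |y 0| := by
      refine (abs_add_le _ _).trans ?_
      rw [abs_mul, abs_mul, abs_of_pos hc]
    have h1 : |(shearUnit n h : ℤ) * y 1 + h * y 0| / n ≤ ((shearUnit n h : ℤ) * |y 1| + |h| * |y 0| + shearUnit n h) / n :=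
      Int.ediv_le_ediv hn0 (by linarith)
    have h3 : (0 : ℤ) ≤ ((shearUnit n h : ℤ) * |y 1| + |h| * |y 0| + shearUnit n h) / n := Int.ediv_nonneg (by positivity) hn0.le
    have h4 : (e.natAbs : ℤ) ≤ (((shearUnit n h : ℤ) * |y 1| + |h| * |y 0| + shearUnit n h) / n).natAbs + 1 := by
      rw [Int.natCast_natAbs, Int.natCast_natAbs, abs_of_nonneg h3]; linarith
    have h5 : e.natAbs ≤ (((shearUnit n h : ℤ) * |y 1| + |h| * |y 0| + shearUnit n h) / n).natAbs + 1 := by exact_mod_cast h4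
    exact Nat.mul_le_mul_left M (by omega)
  · -- the frame coordinates of `g`
    have hα : relCoord φ c₀ 0 g = σ * y 0 := by rw [relCoord_apply, hφ]; exact hz0
    have hβ' : σ * shearCoord φ c₀ n h g = n * e - h * y 0 := by
      have e0 : φ g 0 - φ c₀ 0 = σ * y 0 := by rw [hφ]; exact hz0
      have e1 : φ g 1 - φ c₀ 1 = σ * e := by rw [hφ]; exact hz1
      rw [shearCoord_apply, e0, e1]
      have : σ * ((n : ℤ) * (σ * e) - h * (σ * y 0)) = (σ * σ) * (n * e) - (σ * σ) * (h * y 0) := by ring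
      rw [this, hσσ]; ring
    funext i
    fin_cases i
    · show runX φ c₀ n h σ g 0 = y 0
      rw [runX_zero, hα, ← mul_assoc, hσσ, one_mul]
    · show runX φ c₀ n h σ g 1 = y 1
      rw [runX_one, hβ']
      apply TwoAxis.Para.ediv_eq_of_bounds hc
      · linarith
      · have : (n : ℤ) ≤ (shearUnit n h : ℤ) := by unfold shearUnit; push_cast; linarith [abs_nonneg h, Int.natCast_natAbs h]
        linarith

/-- **The column device of the y′-frame** (coordinates exchanged). [cite: KozmaNitzan2024, §4 p. 26 ((29))] -/
theorem exists_mem_graphBall_runY_eq_q {M : ℕ} (hq : QStepsN G φ M) {n : ℕ} (hn : 1 ≤ n) (c₀ : V) (h : ℤ) {σ : ℤ} (hσ : σ = 1 ∨ σ = -1) (y : Site 2) :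
    ∃ g, g ∈ graphBall G c₀ (M * ((y 1).natAbs + (((shearUnit n h : ℤ) * |y 0| + |h| * |y 1| + shearUnit n h) / n).natAbs + 1)) ∧
      runY φ c₀ n h σ g = y := by
  obtain ⟨g, hg, hrun⟩ := exists_mem_graphBall_runX_eq_q hq hn c₀ h hσ (fun i => if i = 0 then y 1 else y 0)
  refine ⟨g, by simpa using hg, ?_⟩
  funext i
  fin_cases i
  · show runY φ c₀ n h σ g 0 = y 0
    have := congrFun hrun 1
    rw [runX_one] at this
    rw [runY_zero, this]; simp
  · show runY φ c₀ n h σ g 1 = y 1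
    have := congrFun hrun 0
    rw [runX_zero] at this
    rw [runY_one, this]; simp

end Skelφ

end Summit.CriticalPhenomena.PercolationContinuityZ3.Theorems.Transplant

end
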